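import Literature.MathematicalPhysics.QuantumLattice.AndersonXYTorusBound
import Literature.MathematicalPhysics.QuantumLattice.LiebMattisLadder
import HarnessLib

/-!
# Anderson's XY star bound with the sharp constant `k(k+2)/16`

Trunk T-QLATTICE; sharpens `AndersonXYStarBound.lean` / `AndersonXYTorusBound.lean`.
There the spin-½ XY star `T = Σ_{y∈Y}(Sˣ_xSˣ_y + Sʸ_xSʸ_y)` (`x ∉ Y`, `k = |Y|`) was bounded by
`T² ≤ (k+1)²/16`, dropping the square `(Jᶻ)² ≥ 0` of `Jᶻ = Sᶻ_x + Σ_{y∈Y} Sᶻ_y` in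
`T² = ¼[𝐋² - (k(k+2)/4)] + k(k+2)/16 + 1/16 - ¼(Jᶻ)²`. Here we keep it:

* `posSemidef_setSpinZ_sq_sub_quarter`: for a set `Z` with an ODD number of sites,
  **`(Σ_{z∈Z} Sᶻ_z)² ≥ ¼`** (the operator is diagonal in the `Sᶻ` basis with half-odd-integer
  eigenvalues);
* `posSemidef_xyStar_sharp_bound`: hence for EVEN `k`, **`T² ≤ k(k+2)/16`** — sharp: for `k = 4`
  the star ground energy is `-√24/4 = -√6/2 ≈ -1.2247` (vs. `-5/4` from `(k+1)²/16`);
* `neg_xyStar_groundEnergy_ge_sharp`: `E₀(-T) ≥ -√(k(k+2))/4` for even `k`;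
* `xyTorus_one_groundEnergy_ge_sharp`: on the torus `(ℤ/Lℤ)^d`, `L ≥ 3` (so `k = 2d` is even),
  **`E₀(xyTorus d L 1) ≥ -(√(2d(2d+2))/8)·L^d`**, i.e. `-√(2d(2d+2))/(8d)` per bond:
  Anderson's `-√6/8 ≈ -0.3062` per bond in `d = 2` (the value used as the rigorous upper bound
  `κ₁ ≤ √6/8` on the nearest-neighbour transverse correlation of the XY ground state).

No definition is introduced.

## References

* [Anderson1951] P. W. Anderson, *Limits on the Energy of the Antiferromagnetic Ground State*,
  Phys. Rev. 83 (1951) 1260.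
* [Tasaki2020] H. Tasaki, *Physics and Mathematics of Quantum Many-Body Systems* (2020), §2.2.
-/

noncomputable section

open Matrix Complex Finset
open scoped ComplexOrder

namespace Literature.MathematicalPhysics.QuantumLattice

variable {Λ : Type*} [Fintype Λ] [DecidableEq Λ]

/-! ### Parity: `(Σ_{z∈Z} Sᶻ_z)² ≥ ¼` for an odd number of spins ½ -/

section Parity

/-- `Sᶻ_x` (spin ½) is the diagonal single-site matrix `diag(½, -½)` placed at `x`.
Tasaki (2020) §2.1, eq. (2.1.8). [cite: Tasaki2020] -/
theorem siteSpin_one_two_eq_onSite_diagonal (x : Λ) :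
    (siteSpin 1 x 2 : Op Λ 2) =
      onSite x (diagonal fun k : Fin 2 => (1 / 2 : ℂ) - if k = 1 then 1 else 0) := by
  rw [siteSpin_one_eq, ← onSite_smul']
  congr 1
  have h2 : spinHalfPauli 2 = !![1, 0; 0, -1] := rfl
  rw [h2]
  ext i j
  fin_cases i <;> fin_cases j <;> norm_num [diagonal]

/-- `Σ_{z∈Z} Sᶻ_z` (spins ½) is diagonal in the tensor basis, with eigenvalue
`Σ_{z∈Z} (½ - [σ_z = ↓])` on the basis state `σ`. Tasaki (2020) §2.2. [cite: Tasaki2020] -/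
theorem setSpinZ_one_eq_diagonal (Z : Finset Λ) :
    (∑ z ∈ Z, siteSpin 1 z 2 : Op Λ 2) =
      diagonal fun σ => ∑ z ∈ Z, ((1 / 2 : ℂ) - if σ z = 1 then 1 else 0) := by
  rw [Finset.sum_congr rfl fun z _ => siteSpin_one_two_eq_onSite_diagonal z]
  simp_rw [LiebMattis.onSite_diagonal]
  ext σ τ
  simp only [Matrix.sum_apply, diagonal_apply]
  split_ifs <;> simp

/-- **Parity bound**: for an ODD number of spins ½, `(Σ_{z∈Z} Sᶻ_z)² - ¼ ⪰ 0` — the eigenvalues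
`m` of `Σ_{z∈Z} Sᶻ_z` are half-odd-integers, so `m² ≥ ¼`. [folklore] -/
theorem posSemidef_setSpinZ_sq_sub_quarter {Z : Finset Λ} (hZ : Odd Z.card) :
    ((∑ z ∈ Z, siteSpin 1 z 2 : Op Λ 2) * (∑ z ∈ Z, siteSpin 1 z 2) -
      (1 / 4 : ℂ) • (1 : Op Λ 2)).PosSemidef := by
  rw [setSpinZ_one_eq_diagonal, diagonal_mul_diagonal, smul_one_eq_diagonal, diagonal_sub,
    posSemidef_diagonal_iff]
  intro σ
  obtain ⟨k, hk⟩ := hZ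
  rw [Finset.sum_sub_distrib, Finset.sum_const, Finset.sum_boole, nsmul_eq_mul, hk]
  generalize (Z.filter fun z => σ z = 1).card = m
  -- `2·(eigenvalue) = (2k+1) - 2m` is an odd integer, so its square is `≥ 1`
  have h1 : (1 : ℤ) ≤ (2 * ((k : ℤ) - m) + 1) * (2 * ((k : ℤ) - m) + 1) := by
    have h0 : (2 * ((k : ℤ) - m) + 1) ≠ 0 := by omega
    have := mul_self_pos.2 h0
    linarith [Int.lt_iff_add_one_le.mp this]
  have hre : ((((2 * k + 1 : ℕ) : ℂ) * (1 / 2) - (m : ℂ)) * (((2 * k + 1 : ℕ) : ℂ) * (1 / 2) - (m : ℂ)) -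
      1 / 4) = ((((((2 * ((k : ℤ) - m) + 1) * (2 * ((k : ℤ) - m) + 1) - 1 : ℤ)) : ℝ) / 4 : ℝ) : ℂ) := by
    push_cast
    ring
  rw [hre]
  exact Complex.zero_le_real.2 (div_nonneg (by exact_mod_cast sub_nonneg.2 h1) (by norm_num))

end Parity

/-! ### The sharp XY star bound -/

section XYStarSharp

/-- **The sharp XY star bound** (spin ½, `x ∉ Y`, `k = |Y|` even): `T² ≤ k(k+2)/16`, i.e.
`(k(k+2)/16)·1 - T² = ¼[(k(k+2)/4)·1 - 𝐋²] + ¼[(Jᶻ)² - ¼] ⪰ 0` with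
`T = Σ_{y∈Y}(Sˣ_xSˣ_y + Sʸ_xSʸ_y)`, `Jᶻ = Sᶻ_x + Lᶻ` the `z`-spin of the `k+1` (odd) sites of the star.
[cite: Anderson1951] -/
theorem posSemidef_xyStar_sharp_bound {x : Λ} {Y : Finset Λ} (hx : x ∉ Y) (hY : Even Y.card) :
    ((((Y.card : ℂ) * (Y.card + 2) / 16) • (1 : Op Λ 2)) -
      (∑ y ∈ Y, (siteSpin 1 x 0 * siteSpin 1 y 0 + siteSpin 1 x 1 * siteSpin 1 y 1)) *
        ∑ y ∈ Y, (siteSpin 1 x 0 * siteSpin 1 y 0 + siteSpin 1 x 1 * siteSpin 1 y 1)).PosSemidef := by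
  set Lx : Op Λ 2 := ∑ y ∈ Y, siteSpin 1 y 0 with hLx
  set Ly : Op Λ 2 := ∑ y ∈ Y, siteSpin 1 y 1 with hLy
  set Lz : Op Λ 2 := ∑ y ∈ Y, siteSpin 1 y 2 with hLz
  set S : Op Λ 2 := siteSpin 1 x 2 with hS
  set J : Op Λ 2 := Lz + S with hJ
  rw [xyStar_mul_self hx]
  -- the Casimir gap, and the parity bound for `J` = total `Sᶻ` of the `k+1` sites `insert x Y`
  have hgap := posSemidef_casimirBound_sub (Λ := Λ) Y
  rw [Fin.sum_univ_three] at hgap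
  have hJsum : J = ∑ z ∈ insert x Y, siteSpin 1 z 2 := by
    rw [Finset.sum_insert hx, add_comm]
  have hodd : Odd (insert x Y).card := by
    rw [Finset.card_insert_of_notMem hx]
    exact hY.add_one
  have hJpar : (J * J - (1 / 4 : ℂ) • (1 : Op Λ 2)).PosSemidef := by
    rw [hJsum]
    exact posSemidef_setSpinZ_sq_sub_quarter hodd
  have hSLz : S * Lz = Lz * S := (siteSpin_commute_setSpin 1 hx 2 2).eq
  have hJJ : J * J = Lz * Lz + (2 : ℂ) • (S * Lz) + (1 / 4 : ℂ) • 1 := by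
    rw [hJ, Matrix.add_mul, Matrix.mul_add, Matrix.mul_add, hS, siteSpin_one_mul_self, ← hS, hSLz,
      two_smul]
    abel
  -- the identity
  have key : ((((Y.card : ℂ) * (Y.card + 2) / 16)) • (1 : Op Λ 2)) -
      ((1 / 4 : ℂ) • (Lx * Lx + Ly * Ly) - (1 / 2 : ℂ) • (S * Lz)) =
      (1 / 4 : ℂ) • ((((Y.card : ℂ) * (Y.card + 2) / 4) • (1 : Op Λ 2)) -
        (Lx * Lx + Ly * Ly + Lz * Lz)) + (1 / 4 : ℂ) • (J * J - (1 / 4 : ℂ) • 1) := by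
    rw [hJJ]
    simp only [smul_add, smul_sub, smul_smul]
    rw [show (1 / 4 : ℂ) * ((Y.card : ℂ) * (Y.card + 2) / 4) = (Y.card : ℂ) * (Y.card + 2) / 16 by ring]
    norm_num
    abel
  rw [key]
  have h14 : (0 : ℂ) ≤ 1 / 4 := by
    rw [show (1 / 4 : ℂ) = ((1 / 4 : ℝ) : ℂ) by norm_num]
    exact Complex.zero_le_real.2 (by norm_num)
  exact Matrix.PosSemidef.add (hgap.smul h14) (hJpar.smul h14)

/-- **Anderson's XY star energy bound, sharp form** (spin ½, `x ∉ Y`, `k = |Y|` even): the ground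
energy of `-Σ_{y∈Y}(Sˣ_xSˣ_y + Sʸ_xSʸ_y)` is at least `-√(k(k+2))/4` (`= -√6/2` for `k = 4`,
attained). [cite: Anderson1951] -/
theorem neg_xyStar_groundEnergy_ge_sharp [Nonempty Λ] {x : Λ} {Y : Finset Λ} (hx : x ∉ Y)
    (hY : Even Y.card) :
    -(Real.sqrt ((Y.card : ℝ) * (Y.card + 2)) / 4) ≤
      (-(∑ y ∈ Y, (siteSpin 1 x 0 * siteSpin 1 y 0 + siteSpin 1 x 1 * siteSpin 1 y 1)) :
        Op Λ 2).groundEnergy := by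
  haveI : Nonempty (TensorIndex Λ 2) := ⟨fun _ => 0⟩
  set T : Op Λ 2 := ∑ y ∈ Y, (siteSpin 1 x 0 * siteSpin 1 y 0 + siteSpin 1 x 1 * siteSpin 1 y 1)
    with hT
  have hTh : T.IsHermitian := by
    rw [hT, IsHermitian, conjTranspose_sum]
    refine Finset.sum_congr rfl fun y hy => ?_
    have hxy : x ≠ y := (ne_of_mem_of_not_mem hy hx).symm
    rw [conjTranspose_add, conjTranspose_mul, conjTranspose_mul, (siteSpin_isHermitian 1 x 0).eq,
      (siteSpin_isHermitian 1 y 0).eq, (siteSpin_isHermitian 1 x 1).eq, (siteSpin_isHermitian 1 y 1).eq,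
      (siteSpin_commute_of_ne_holds 1 hxy 0 0).eq, (siteSpin_commute_of_ne_holds 1 hxy 1 1).eq]
  have hk : (0 : ℝ) ≤ (Y.card : ℝ) * (Y.card + 2) := by positivity
  have hsq : (((Real.sqrt ((Y.card : ℝ) * (Y.card + 2)) / 4) ^ 2 : ℝ) : ℂ) • (1 : Op Λ 2) -
      (-T) * (-T) = (((Y.card : ℂ) * (Y.card + 2) / 16) • (1 : Op Λ 2)) - T * T := by
    rw [neg_mul_neg, div_pow, Real.sq_sqrt hk]
    congr 2
    push_cast
    ring
  have hpsd : ((((Real.sqrt ((Y.card : ℝ) * (Y.card + 2)) / 4) ^ 2 : ℝ) : ℂ) • (1 : Op Λ 2) -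
      (-T) * (-T)).PosSemidef := by
    rw [hsq]
    exact posSemidef_xyStar_sharp_bound hx hY
  have h := Matrix.neg_sqrt_le_groundEnergy_of_sq_le hTh.neg hpsd
  rwa [Real.sqrt_sq (by positivity)] at h

end XYStarSharp

/-! ### The torus corollary with the sharp constant -/

section XYTorusSharp

open Literature.Probability.LatticeModels

variable {d : ℕ} (L : ℕ) [NeZero L]

/-- **Anderson's lower bound for the spin-½ ferromagnetic XY model on `(ℤ/Lℤ)^d`, sharp star
constant** (`L ≥ 3`): `E₀(xyTorus d L 1) ≥ -(√(2d(2d+2))/8)·L^d`, i.e. `-√(2d(2d+2))/(8d)` per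
bond — `-√6/8` in `d = 2`. Same star decomposition as `xyTorus_one_groundEnergy_ge`, with
`neg_xyStar_groundEnergy_ge_sharp` (`k = 2d` is even). [cite: Anderson1951] -/
theorem xyTorus_one_groundEnergy_ge_sharp (hL : 3 ≤ L) :
    -((Real.sqrt (2 * (d : ℝ) * (2 * (d : ℝ) + 2)) / 8) * (L : ℝ) ^ d) ≤
      (xyTorus d L 1).groundEnergy := by
  haveI : Nonempty (TensorIndex (TorusSite d L) 2) := ⟨fun _ => 0⟩
  have hL2 : 2 ≤ L := by omega
  -- bond operators and stars
  set f : TorusSite d L → TorusSite d L → Op (TorusSite d L) 2 := fun x y =>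
    siteSpin 1 x 0 * siteSpin 1 y 0 + siteSpin 1 x 1 * siteSpin 1 y 1 with hf
  have hfsymm : ∀ {x y : TorusSite d L}, x ≠ y → f x y = f y x := by
    intro x y hxy
    simp only [hf, (siteSpin_commute_of_ne_holds 1 hxy 0 0).eq, (siteSpin_commute_of_ne_holds 1 hxy 1 1).eq]
  set nbr : TorusSite d L → Fin d × Bool → TorusSite d L := fun x p =>
    if p.2 then x + Pi.single p.1 (1 : ZMod L) else x - Pi.single p.1 1 with hnbr
  set Y : TorusSite d L → Finset (TorusSite d L) := fun x => Finset.univ.image (nbr x) with hY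
  set T : TorusSite d L → Op (TorusSite d L) 2 := fun x => ∑ y ∈ Y x, f x y with hT
  have hne : ∀ (x : TorusSite d L) (i : Fin d), x ≠ x + Pi.single i 1 := by
    intro x i h
    exact single_ne_zero_of_two_le L hL2 i (by simpa using h.symm)
  have hne' : ∀ (x : TorusSite d L) (i : Fin d), x ≠ x - Pi.single i 1 := by
    intro x i h
    exact single_ne_zero_of_two_le L hL2 i (by simpa [sub_eq_add_neg] using h.symm)
  have hxY : ∀ x, x ∉ Y x := by
    intro x hx
    rw [hY, Finset.mem_image] at hx
    obtain ⟨⟨i, b⟩, -, hb⟩ := hx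
    cases b
    · exact hne' x i (by simpa [hnbr] using hb.symm)
    · exact hne x i (by simpa [hnbr] using hb.symm)
  have hcard : ∀ x, (Y x).card = 2 * d := by
    intro x
    rw [hY, Finset.card_image_of_injective _ (torusNbr_injective L hL x), Finset.card_univ,
      Fintype.card_prod, Fintype.card_fin, Fintype.card_bool, mul_comm]
  -- `T_x = Σᵢ (f(x, x+eᵢ) + f(x, x-eᵢ))`
  have hTsum : ∀ x, T x = ∑ i : Fin d, (f x (x + Pi.single i 1) + f x (x - Pi.single i 1)) := by
    intro x
    rw [hT]
    dsimp only
    rw [hY, Finset.sum_image fun p _ q _ h => torusNbr_injective L hL x h, Fintype.sum_prod_type]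
    refine Finset.sum_congr rfl fun i _ => ?_
    rw [Fintype.sum_bool]
    rfl
  -- `H = -Σ_x Σᵢ f(x, x+eᵢ)`
  have hH : xyTorus d L 1 = -∑ x : TorusSite d L, ∑ i : Fin d, f x (x + Pi.single i 1) := by
    rw [xyTorus_eq_bondSum, ← sum_pairs_eq_sum_edgeFinset' L hL, ← Finset.sum_neg_distrib]
    refine Finset.sum_congr rfl fun x _ => ?_
    rw [← Finset.sum_neg_distrib]
    refine Finset.sum_congr rfl fun i _ => ?_
    rw [Sym2.lift_mk]
    dsimp only
    rw [spinBond_eq_mul_of_ne (hne x i) 0, spinBond_eq_mul_of_ne (hne x i) 1]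
    simp only [hf, Complex.ofReal_neg, Complex.ofReal_one, neg_smul, one_smul, Complex.ofReal_zero,
      zero_smul, add_zero, neg_add]
  -- `Σ_x f(x, x-eᵢ) = Σ_x f(x, x+eᵢ)`
  have hshift : ∀ i : Fin d, ∑ x : TorusSite d L, f x (x - Pi.single i 1) =
      ∑ x : TorusSite d L, f x (x + Pi.single i 1) := by
    intro i
    rw [← Equiv.sum_comp (Equiv.addRight (Pi.single i (1 : ZMod L)))]
    refine Finset.sum_congr rfl fun x _ => ?_
    simp only [Equiv.coe_addRight, add_sub_cancel_right]
    exact hfsymm (hne x i).symm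
  have hminus : (∑ x : TorusSite d L, ∑ i : Fin d, f x (x - Pi.single i 1)) =
      ∑ x : TorusSite d L, ∑ i : Fin d, f x (x + Pi.single i 1) := by
    rw [Finset.sum_comm, Finset.sum_congr rfl fun i _ => hshift i, Finset.sum_comm]
  have h2 : (2 : ℂ) • xyTorus d L 1 = -∑ x : TorusSite d L, T x := by
    rw [two_smul]
    conv_lhs => rw [hH]
    rw [← neg_add, ← Finset.sum_add_distrib, Finset.sum_congr rfl fun x _ => (hTsum x)]
    congr 1
    simp only [Finset.sum_add_distrib]
    rw [hminus]
  have hH' : xyTorus d L 1 = ∑ x : TorusSite d L, (((1 / 2 : ℝ) : ℂ) • (-T x)) := by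
    calc xyTorus d L 1 = (1 / 2 : ℂ) • ((2 : ℂ) • xyTorus d L 1) := by
          rw [smul_smul]; norm_num
      _ = (1 / 2 : ℂ) • (-∑ x : TorusSite d L, T x) := by rw [h2]
      _ = ∑ x : TorusSite d L, (((1 / 2 : ℝ) : ℂ) • (-T x)) := by
          rw [← Finset.sum_neg_distrib, Finset.smul_sum]
          push_cast
          rfl
  -- Hermiticity of the stars
  have hTh : ∀ x, (-T x).IsHermitian := by
    intro x
    refine Matrix.IsHermitian.neg ?_
    rw [hT]
    dsimp only
    rw [IsHermitian, conjTranspose_sum]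
    refine Finset.sum_congr rfl fun y hy => ?_
    have hxy : x ≠ y := (ne_of_mem_of_not_mem hy (hxY x)).symm
    simp only [hf, conjTranspose_add, conjTranspose_mul, (siteSpin_isHermitian 1 x 0).eq,
      (siteSpin_isHermitian 1 y 0).eq, (siteSpin_isHermitian 1 x 1).eq, (siteSpin_isHermitian 1 y 1).eq,
      (siteSpin_commute_of_ne_holds 1 hxy 0 0).eq, (siteSpin_commute_of_ne_holds 1 hxy 1 1).eq]
  -- assemble
  rw [hH']
  refine le_trans ?_ (Matrix.groundEnergy_sum_ge _ fun x _ => (hTh x).ofReal_smul _)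
  have hstar : ∀ x : TorusSite d L, -(Real.sqrt (2 * (d : ℝ) * (2 * (d : ℝ) + 2)) / 8) ≤
      ((((1 / 2 : ℝ) : ℂ) • (-T x)).groundEnergy) := by
    intro x
    rw [Matrix.groundEnergy_smul_of_pos (hTh x) (by norm_num : (0 : ℝ) < 1 / 2)]
    have heven : Even (Y x).card := by
      rw [hcard x]
      exact even_two_mul d
    have h := neg_xyStar_groundEnergy_ge_sharp (Λ := TorusSite d L) (hxY x) heven
    rw [hcard x] at h
    push_cast at h
    have : -(Real.sqrt (2 * (d : ℝ) * (2 * (d : ℝ) + 2)) / 8) =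
        1 / 2 * (-(Real.sqrt (2 * (d : ℝ) * (2 * (d : ℝ) + 2)) / 4)) := by ring
    rw [this]
    exact mul_le_mul_of_nonneg_left h (by norm_num)
  calc -((Real.sqrt (2 * (d : ℝ) * (2 * (d : ℝ) + 2)) / 8) * (L : ℝ) ^ d)
      = ∑ _x : TorusSite d L, -(Real.sqrt (2 * (d : ℝ) * (2 * (d : ℝ) + 2)) / 8) := by
        rw [Finset.sum_const, Finset.card_univ, nsmul_eq_mul]
        have : (Fintype.card (TorusSite d L) : ℝ) = (L : ℝ) ^ d := by
          rw [show Fintype.card (TorusSite d L) = L ^ d by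
            rw [Fintype.card_fun, ZMod.card, Fintype.card_fin]]
          push_cast; ring
        rw [this]; ring
    _ ≤ ∑ x : TorusSite d L, ((((1 / 2 : ℝ) : ℂ) • (-T x)).groundEnergy) :=
        Finset.sum_le_sum fun x _ => hstar x

end XYTorusSharp

end Literature.MathematicalPhysics.QuantumLattice
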